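import Summits.KontsevichZagierPeriods.KontsevichZagierPeriods.Theses.HurwitzMicroSectors
import Summits.KontsevichZagierPeriods.KontsevichZagierPeriods.Theorems.HurwitzMicroSectorsNormalFormPrinciplePiBoxTransfer
import Summits.KontsevichZagierPeriods.KontsevichZagierPeriods.Theorems.HurwitzMicroSectorsNormalFormPrincipleVariants2283

/-! TTRL-lite variant V2274 of stmt-KontsevichZagierPeriods-3869

Variant V2274 = `stub_boxRigidity` (the leaf `BoxRigidity` of `NormalFormPrinciple`: two representations
on open unit boxes with integrands of KZ's rational shape `p/q` over `ℚ` and equal values are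
KZ-equivalent) with BOTH dimensions frozen, `fix m := 4; fix m' := 5`. Verdict of the attempt seat:
**open** — this file is the exact-strength certificate, not a proof of the variant. By the general
pair lemma of the sibling certificate `…Variants2283` (`boxRigidityPair_iff_boxVanishingDim K m₀`:
a two-sided freeze is exactly `BoxVanishing (max K m₀)` — compare with the zero representation on the
other box for (⇒); pad both representations to the larger box by unit intervals and subtract there for
(⇐)), `V2274 ⟺ BoxVanishing 5 ⟺ BoxRigidity(m, m' ≤ 5) ⟺ V2283`
(`stub_boxRigidity_var2274_iff_boxVanishing_five`, `stub_boxRigidity_var2274_iff_le_five`,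
`stub_boxRigidity_var2274_iff_var2283`): every `ℚ`-rational absolutely convergent `∫_{(0,1)⁵} p/q` of
value `0` is generated by the four moves. This contains the level `2` (vanishing combinations of `π²`,
Catalan's `G`, `Li₂` at rationals, `log·log`, `L(2,χ)`, …), decided today by no theorem; the tree's
knowledge stops at `m, m' ≤ 1` (`boxRigidity_of_le_one`, Baker). Conversely
`KontsevichZagierPeriods → V2274` (`stub_boxRigidity_var2274_of_statement`), so a refutation of the
variant would refute the Summit, and the tree has no invariant of `KZ.relations` finer than `eval`:
neither side is reachable here.
Source: M. Kontsevich, D. Zagier, *Periods* (2001), §1.2 Conjecture 1. Pure proof file, no definitions. -/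

-- `Summit.<Summit>.<Problem>` is the tree's mandated summit-side namespace (CONVENTIONS §2); for this
-- single-conjunct summit the two coincide, so the duplicate is deliberate.
set_option linter.dupNamespace false

noncomputable section

namespace Summit.KontsevichZagierPeriods.KontsevichZagierPeriods.Theorems

open MeasureTheory Set
open Literature.NumberTheory.Transcendental Literature.NumberTheory.Transcendental.KZ
open Summit.KontsevichZagierPeriods.KontsevichZagierPeriods.Theses.HurwitzMicroSectors
open Summit.KontsevichZagierPeriods.HurwitzMicroSectors.NormalFormPrinciple.PiBox

/-! ## The variant V2274: exactly `BoxVanishing 5` -/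

/-- **V2274 ⟺ `BoxVanishing 5`**: a box-rational representation on the `5`-box of value `0` is a
relation (`boxRigidityPair_iff_boxVanishingDim 4 5`, `max 4 5 = 5`).
[cite: KontsevichZagier2001, §1.2 Conjecture 1] -/
theorem stub_boxRigidity_var2274_iff_boxVanishing_five :
    (∀ (N : IntegralRep 4) (N' : IntegralRep 5), N.domain = {x | ∀ i, x i ∈ Set.Ioo (0:ℝ) 1} → N.IsRational → N'.domain = {x | ∀ i, x i ∈ Set.Ioo (0:ℝ) 1} → N'.IsRational → N.value = N'.value → Equivalent N N') ↔
    (∀ (M : IntegralRep 5), M.domain = {x | ∀ i, x i ∈ Set.Ioo (0:ℝ) 1} →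
      M.IsRational → M.value = 0 → of M ∈ relations) :=
  boxRigidityPair_iff_boxVanishingDim 4 5

/-- **V2274 ⟺ the two-sided bounded leaf `BoxRigidity(m, m' ≤ 5)`** — strictly between the tree's
theorem `boxRigidity_of_le_one` (`m, m' ≤ 1`, Baker) and the full leaf; the level `2` it contains is
open. [cite: KontsevichZagier2001, §1.2 Conjecture 1] -/
theorem stub_boxRigidity_var2274_iff_le_five :
    (∀ (N : IntegralRep 4) (N' : IntegralRep 5), N.domain = {x | ∀ i, x i ∈ Set.Ioo (0:ℝ) 1} → N.IsRational → N'.domain = {x | ∀ i, x i ∈ Set.Ioo (0:ℝ) 1} → N'.IsRational → N.value = N'.value → Equivalent N N') ↔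
    (∀ (m m' : ℕ) (N : IntegralRep m) (N' : IntegralRep m'), m ≤ 5 → m' ≤ 5 →
      N.domain = {x | ∀ i, x i ∈ Set.Ioo (0:ℝ) 1} → N.IsRational →
      N'.domain = {x | ∀ i, x i ∈ Set.Ioo (0:ℝ) 1} → N'.IsRational →
      N.value = N'.value → Equivalent N N') :=
  boxRigidityPair_iff_boxRigidityLe 4 5

/-- **V2274 ⟺ V2283** (`fix m := 4; fix m' := 5` and `fix m := 5; fix m' := 2` have the same
strength, `BoxVanishing 5`). [cite: KontsevichZagier2001, §1.2 Conjecture 1] -/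
theorem stub_boxRigidity_var2274_iff_var2283 :
    (∀ (N : IntegralRep 4) (N' : IntegralRep 5), N.domain = {x | ∀ i, x i ∈ Set.Ioo (0:ℝ) 1} → N.IsRational → N'.domain = {x | ∀ i, x i ∈ Set.Ioo (0:ℝ) 1} → N'.IsRational → N.value = N'.value → Equivalent N N') ↔
    (∀ (N : IntegralRep 5) (N' : IntegralRep 2), N.domain = {x | ∀ i, x i ∈ Set.Ioo (0:ℝ) 1} → N.IsRational → N'.domain = {x | ∀ i, x i ∈ Set.Ioo (0:ℝ) 1} → N'.IsRational → N.value = N'.value → Equivalent N N') := by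
  rw [stub_boxRigidity_var2274_iff_boxVanishing_five, stub_boxRigidity_var2283_iff_boxVanishing_five]

/-- **V2274 ⇒ `BoxVanishing` in every dimension `≤ 5`** (monotonicity along padding, through the
bounded leaf): in particular the dimension-`2` statement that every vanishing box-rational
`∫_{(0,1)²} P/Q` is generated by the moves. [cite: KontsevichZagier2001, §1.2 Conjecture 1] -/
theorem boxVanishing_le_five_of_stub_boxRigidity_var2274
    (h : ∀ (N : IntegralRep 4) (N' : IntegralRep 5), N.domain = {x | ∀ i, x i ∈ Set.Ioo (0:ℝ) 1} → N.IsRational → N'.domain = {x | ∀ i, x i ∈ Set.Ioo (0:ℝ) 1} → N'.IsRational → N.value = N'.value → Equivalent N N')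
    {j : ℕ} (hj : j ≤ 5) (N : IntegralRep j) (hNd : N.domain = {x | ∀ i, x i ∈ Set.Ioo (0:ℝ) 1})
    (hNr : N.IsRational) (hv : N.value = 0) : of N ∈ relations :=
  boxVanishing_le_five_of_stub_boxRigidity_var2283 (stub_boxRigidity_var2274_iff_var2283.1 h) hj N
    hNd hNr hv

/-- **V2283 ⇒ V2274** (the sibling two-sided freeze of the same strength).
[cite: KontsevichZagier2001, §1.2 Conjecture 1] -/
theorem stub_boxRigidity_var2274_of_var2283
    (h : ∀ (N : IntegralRep 5) (N' : IntegralRep 2), N.domain = {x | ∀ i, x i ∈ Set.Ioo (0:ℝ) 1} → N.IsRational → N'.domain = {x | ∀ i, x i ∈ Set.Ioo (0:ℝ) 1} → N'.IsRational → N.value = N'.value → Equivalent N N') :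
    ∀ (N : IntegralRep 4) (N' : IntegralRep 5), N.domain = {x | ∀ i, x i ∈ Set.Ioo (0:ℝ) 1} → N.IsRational → N'.domain = {x | ∀ i, x i ∈ Set.Ioo (0:ℝ) 1} → N'.IsRational → N.value = N'.value → Equivalent N N' :=
  stub_boxRigidity_var2274_iff_var2283.2 h

/-- **The parent leaf ⇒ V2274** (specialisation `m = 4`, `m' = 5`).
[cite: KontsevichZagier2001, §1.2 Conjecture 1] -/
theorem stub_boxRigidity_var2274_of_parent
    (h : ∀ (m m' : ℕ) (N : IntegralRep m) (N' : IntegralRep m'), N.domain = {x | ∀ i, x i ∈ Set.Ioo (0:ℝ) 1} → N.IsRational → N'.domain = {x | ∀ i, x i ∈ Set.Ioo (0:ℝ) 1} → N'.IsRational → N.value = N'.value → Equivalent N N') :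
    ∀ (N : IntegralRep 4) (N' : IntegralRep 5), N.domain = {x | ∀ i, x i ∈ Set.Ioo (0:ℝ) 1} → N.IsRational → N'.domain = {x | ∀ i, x i ∈ Set.Ioo (0:ℝ) 1} → N'.IsRational → N.value = N'.value → Equivalent N N' :=
  h 4 5

/-- **`KontsevichZagierPeriods ⇒ V2274`**: the variant is a special case of Conjecture 1 for the
tree's calculus (`leaves_of_statement`) — so a refutation of the variant would refute the Summit.
[cite: KontsevichZagier2001, §1.2 Conjecture 1] -/
theorem stub_boxRigidity_var2274_of_statement (h : _root_.KontsevichZagierPeriods) :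
    ∀ (N : IntegralRep 4) (N' : IntegralRep 5), N.domain = {x | ∀ i, x i ∈ Set.Ioo (0:ℝ) 1} → N.IsRational → N'.domain = {x | ∀ i, x i ∈ Set.Ioo (0:ℝ) 1} → N'.IsRational → N.value = N'.value → Equivalent N N' :=
  (leaves_of_statement h).1 4 5

end Summit.KontsevichZagierPeriods.KontsevichZagierPeriods.Theorems

end
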